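import Summits.HodgeConjecture.HodgeConjecture.Theses.EndoscopicMiddleDegree

/-!
# Route EndoscopicMiddleDegree — ThetaStep (item stmt-HodgeConjecture-14351)

The glue item `ThetaStep : CupProductAlgebraic → MiddleThetaSpan → MiddleDegreeStep` of route
`route-HodgeConjecture-EndoscopicMiddleDegree`.

`MiddleThetaSpan` (the heart) puts every rational Hodge `(m+1, m+1)`-class `c` on a ball quotient
`X` (datum `D : UnitaryBallQuotientDatum (2(m+1)) X`) into the sum of three subspaces of
`H^{2(m+1)}(X(ℂ); ℂ)`:

1. the special cycle classes `SC^{m+1}(D) ⊗ ℂ` — the `⨆` over totally positive definite `W ⊆ V`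
   of `E`-dimension `m + 1` of the classes supported on the special subvariety `c(W)`;
2. the span of the cup products `s ∪ d`, `s ∈ SC^{m}(D) ⊗ ℂ`, `d ∈ algebraicClasses X 1`;
3. the span of the cup products `a ∪ d`, `a` a rational Hodge `(m, m)`-class,
   `d ∈ algebraicClasses X 1`.

Each lies in `algebraicClasses X (m + 1)`: (1) each special subvariety `c(W)` is Zariski closed of
codimension `≥ dim_E W` (fields `isClosed_specialSubvariety`, `le_coheight_of_mem_specialSubvariety`
of the datum), so the classes supported on it are supported in codimension `≥ m + 1`
(`classesSupportedOn_le_supportedClasses`), i.e. algebraic; (2) the same in codimension `m` for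
`s`, then `CupProductAlgebraic` (products of algebraic classes are algebraic, `X` being smooth
projective by `D.isSmoothProjective`); (3) `a` is algebraic by the degree-`2m` hypothesis of
`MiddleDegreeStep`, then `CupProductAlgebraic` again. `sup_le` and `Submodule.span_le` assemble the
three bounds.
-/

-- `Summit.HodgeConjecture.HodgeConjecture.Theorems` is the mandated namespace (single-problem summit:
-- Problem = Summit), which `linter.dupNamespace` flags on every declaration; the lakefile turns the
-- linter off tree-wide (weak option), restated here so stand-alone elaboration is warning-free too.
set_option linter.dupNamespace false

namespace Summit.HodgeConjecture.HodgeConjecture.Theorems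

open Summit.HodgeConjecture.HodgeConjecture.Theses.EndoscopicMiddleDegree
open Literature.AlgebraicGeometry.HodgeTheory Literature.AlgebraicGeometry.ShimuraVarieties

/-- On a ball quotient presented by `D : UnitaryBallQuotientDatum p X`, the classes supported on the
special subvariety `c(W)` of a totally positive definite `W` of `E`-dimension `k`, in degree `2k`,
are algebraic classes of codimension `k` (`c(W)` is Zariski closed of codimension `≥ k`). -/
theorem classesSupportedOn_specialSubvariety_le_algebraicClasses {p : ℕ}
    {X : Literature.AlgebraicGeometry.Motives.SchemeOver ℂ} (D : UnitaryBallQuotientDatum p X)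
    {W : Submodule D.E (Fin (p + 1) → D.E)} (hW : IsTotallyPositive (conjRingHom D.E) D.H W)
    {k : ℕ} (hk : Module.finrank D.E W = k) :
    classesSupportedOn X (D.specialSubvariety W) (2 * k) ≤ algebraicClasses X k := by
  subst hk
  exact classesSupportedOn_le_supportedClasses (D.isClosed_specialSubvariety W hW)
    (D.le_coheight_of_mem_specialSubvariety W hW) _

/-- **ThetaStep** (item stmt-HodgeConjecture-14351 of route EndoscopicMiddleDegree): the glue
`CupProductAlgebraic → MiddleThetaSpan → MiddleDegreeStep`. Given the datum `D`, `MiddleThetaSpan`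
places a rational Hodge `(m+1,m+1)`-class in
`SC^{m+1} ⊔ span (SC^{m} ∪ Div) ⊔ span (Hdg^{m,m}_ℚ ∪ Div)`; special cycle classes are algebraic
(special subvarieties are closed of the right codimension), rational Hodge `(m,m)`-classes are
algebraic by the hypothesis of `MiddleDegreeStep`, divisor classes are algebraic by definition, and
cup products of algebraic classes are algebraic by `CupProductAlgebraic`; conclude by `sup_le`. -/
theorem thetaStep_proof :
    Summit.HodgeConjecture.HodgeConjecture.Theses.EndoscopicMiddleDegree.ThetaStep := by
  unfold ThetaStep
  intro hcup hspan m X h1 h2 hD hlow c hc hH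
  obtain ⟨D⟩ := hD
  have hX : Literature.AlgebraicGeometry.Motives.IsSmoothProjective (2 * (m + 1)) X :=
    D.isSmoothProjective
  have key := hspan m X D h1 h2 c hc hH
  refine (sup_le (sup_le ?_ ?_) ?_ : _ ≤ algebraicClasses X (m + 1)) key
  · exact iSup_le fun W ↦ iSup_le fun hW ↦ iSup_le fun hk ↦
      classesSupportedOn_specialSubvariety_le_algebraicClasses D hW hk
  · refine Submodule.span_le.2 ?_
    rintro z ⟨s, hs, d, hd, rfl⟩
    refine hcup hX m 1 s d ?_ hd
    exact (iSup_le fun W ↦ iSup_le fun hW ↦ iSup_le fun hk ↦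
      classesSupportedOn_specialSubvariety_le_algebraicClasses D hW hk) hs
  · refine Submodule.span_le.2 ?_
    rintro z ⟨a, ha, haH, d, hd, rfl⟩
    exact hcup hX m 1 a d (hlow a ha haH) hd

end Summit.HodgeConjecture.HodgeConjecture.Theorems
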